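import Mathlib
import Summits.Ventures.PercRepro.TriangleCapEightThirteenC

/-!
# PercRepro — THE CELL `(8, 13)`, PART D: FOUR TRIANGLES (p3, gen 37; part 76)

Four triangles on `8` vertices with `13` edges (every triangle one of the four, as pairs): the four pair sets are
disjoint and carry `24` of the `26` ordered adjacent pairs, the two others form ONE edge `x y` lying in no triangle;
`Σ deficit ≥ 40 + 4 Σ |outer| + 2 deficit(x, y)`, and either both ends of `x y` lie in at most one triangle (then
`d(x) + d(y) ≤ 6` and `deficit(x, y) ≥ 2`) or an end lies in two (then a triangle has an outer vertex,
`outer_of_two_through`), or an end lies in none (then it is itself outer for a triangle not containing the other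
end, `exists_not_mem_of_four`); in every case `Σ deficit ≥ 44 = 4k − 12 + |T₃|` (`|T₃| ≤ 24`).

* **`four_triangles_eight_thirteen`** — the `r = 2` bound at `(8, 13)` for four triangles.
Axioms: standard.
-/

namespace PercRepro

namespace TriangleCap

namespace C047

open Finset

variable {V : Type*} [Fintype V] [DecidableEq V]

/-- **FOUR TRIANGLES AT `(8, 13)`.** -/
theorem four_triangles_eight_thirteen (D : SimpleGraph V) [DecidableRel D.Adj] (hK : K4mFree D)
    (hk : Fintype.card V = 8) (hm : D.edgeFinset.card = 13) (F : Finset (Finset V)) (hF4 : F.card = 4)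
    (hF : ∀ T ∈ F, ∃ u v w, D.Adj u v ∧ D.Adj u w ∧ D.Adj v w ∧ T = {u, v, w})
    (hT : ∀ x y z, D.Adj x y → D.Adj x z → D.Adj y z → ∃ T ∈ F, x ∈ T ∧ y ∈ T) :
    ∑ v, deg D v * deg D v + 2 * (Fintype.card V - 3) ≤ D.edgeFinset.card * Fintype.card V := by
  set P : Finset V → Finset (V × V) := fun T => (T ×ˢ T).filter (fun p : V × V => D.Adj p.1 p.2) with hPdef
  have hcl : ∀ T ∈ F, ∀ a ∈ T, ∀ b ∈ T, a ≠ b → D.Adj a b := by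
    intro T hT'
    obtain ⟨u, v, w, huv, huw, hvw, rfl⟩ := hF T hT'
    exact clique_triple D huv huw hvw
  have hP6 : ∀ T ∈ F, (P T).card = 6 := by
    intro T hT'
    obtain ⟨u, v, w, huv, huw, hvw, rfl⟩ := hF T hT'
    exact card_pairs_triangle D huv huw hvw
  have hPdisj : ∀ T ∈ F, ∀ T' ∈ F, T ≠ T' → Disjoint (P T) (P T') := by
    intro T hT' T' hT'' hne
    obtain ⟨u, v, w, huv, huw, hvw, rfl⟩ := hF T hT'
    obtain ⟨u', v', w', huv', huw', hvw', rfl⟩ := hF T' hT''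
    exact pairs_disjoint_of_ne D hK huv huw hvw huv' huw' hvw' hne
  have hPsub : ∀ T, P T ⊆ adjPairsAll D := by
    intro T p hp
    rw [hPdef] at hp
    simp only [mem_filter] at hp
    rw [mem_adjPairsAll]
    exact hp.2
  have hmemP : ∀ T p, p ∈ P T ↔ p.1 ∈ T ∧ p.2 ∈ T ∧ D.Adj p.1 p.2 := by
    intro T p
    rw [hPdef]
    simp only [mem_filter, mem_product, and_assoc]
  -- the union of the pair sets
  set U := F.biUnion P with hU
  have hUcard : U.card = 24 := by
    rw [hU, card_biUnion hPdisj, sum_congr rfl hP6, sum_const, hF4, smul_eq_mul]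
  have hUsub : U ⊆ adjPairsAll D := by
    intro p hp
    rw [hU, mem_biUnion] at hp
    obtain ⟨T, _, hp⟩ := hp
    exact hPsub T hp
  have hall : (adjPairsAll D).card = 26 := by rw [card_adjPairsAll, hm]
  have hRcard : (adjPairsAll D \ U).card = 2 := by
    rw [card_sdiff, inter_eq_left.mpr hUsub, hall, hUcard]
  -- the remaining two pairs form one edge `x y`
  obtain ⟨p, hp⟩ := card_pos.mp (by omega : 0 < (adjPairsAll D \ U).card)
  rw [mem_sdiff, mem_adjPairsAll] at hp
  obtain ⟨hxy, hpU⟩ := hp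
  have hswapU : (p.2, p.1) ∉ U := by
    intro h
    rw [hU, mem_biUnion] at h
    obtain ⟨T, hTF, hT'⟩ := h
    rw [hmemP] at hT'
    apply hpU
    rw [hU, mem_biUnion]
    exact ⟨T, hTF, (hmemP T p).mpr ⟨hT'.2.1, hT'.1, hxy⟩⟩
  have hswapR : (p.2, p.1) ∈ adjPairsAll D \ U := mem_sdiff.mpr ⟨(mem_adjPairsAll D _).mpr hxy.symm, hswapU⟩
  have hpR : p ∈ adjPairsAll D \ U := mem_sdiff.mpr ⟨(mem_adjPairsAll D _).mpr hxy, hpU⟩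
  have hpne : p ≠ (p.2, p.1) := by
    intro h
    exact hxy.ne (Prod.mk.inj (by rw [← h] : (p.1, p.2) = (p.2, p.1))).1
  have hReq : adjPairsAll D \ U = {p, (p.2, p.1)} := by
    symm
    apply eq_of_subset_of_card_le
    · intro q hq
      rw [mem_insert, mem_singleton] at hq
      rcases hq with rfl | rfl
      · exact hpR
      · exact hswapR
    · rw [card_pair hpne, hRcard]
  -- the deficit sum decomposes
  have hsplit := sum_sdiff (f := deficit D) hUsub
  have hRsum : ∑ q ∈ adjPairsAll D \ U, deficit D q = 2 * deficit D p := by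
    rw [hReq, sum_pair hpne, deficit_swap D p.2 p.1]
    ring
  have hUsum : ∑ q ∈ U, deficit D q = ∑ T ∈ F, ∑ q ∈ P T, deficit D q := by
    rw [hU, sum_biUnion hPdisj]
  -- every pair set pays `10 + 4 |outer|`
  have hout : ∀ T ∈ F, 10 + 4 * (univ.filter (fun z => ∀ t ∈ T, ¬ D.Adj t z)).card ≤ ∑ q ∈ P T, deficit D q := by
    intro T hT'
    obtain ⟨u, v, w, huv, huw, hvw, rfl⟩ := hF T hT'
    have h := sum_deficit_pairs_triangle D hK huv huw hvw
    rw [hk] at h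
    have e : univ.filter (fun z => ∀ t ∈ ({u, v, w} : Finset V), ¬ D.Adj t z) = outer D u v w := by
      unfold outer
      apply filter_congr
      intro z _
      simp only [mem_insert, mem_singleton, forall_eq_or_imp, forall_eq]
    rw [e]
    exact h
  -- the membership dichotomy for adjacent pairs
  have hmem : ∀ v z, D.Adj v z → (∃ T ∈ F, v ∈ T ∧ z ∈ T) ∨ (v = p.1 ∧ z = p.2) ∨ (v = p.2 ∧ z = p.1) := by
    intro v z hvz
    by_cases hin : (v, z) ∈ U
    · rw [hU, mem_biUnion] at hin
      obtain ⟨T, hTF, h⟩ := hin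
      rw [hmemP] at h
      exact Or.inl ⟨T, hTF, h.1, h.2.1⟩
    · have : (v, z) ∈ adjPairsAll D \ U := mem_sdiff.mpr ⟨(mem_adjPairsAll D _).mpr hvz, hin⟩
      rw [hReq, mem_insert, mem_singleton] at this
      rcases this with h | h
      · exact Or.inr (Or.inl ⟨(Prod.mk.inj h).1, (Prod.mk.inj h).2⟩)
      · exact Or.inr (Or.inr ⟨(Prod.mk.inj h).1, (Prod.mk.inj h).2⟩)
  have hxyU : ∀ T ∈ F, ¬ (p.1 ∈ T ∧ p.2 ∈ T) := by
    intro T hTF h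
    apply hpU
    rw [hU, mem_biUnion]
    exact ⟨T, hTF, (hmemP T p).mpr ⟨h.1, h.2, hxy⟩⟩
  -- `|T₃| ≤ 24`
  have h24 : (triangles3 D).card ≤ 24 := by
    have hmaps : Set.MapsTo (fun t : (V × V) × V => t.1) (triangles3 D : Set ((V × V) × V)) (U : Set (V × V)) := by
      intro s hs
      rw [mem_coe, triangles3, mem_filter, mem_product, mem_adjPairsAll] at hs
      obtain ⟨⟨hxy', -⟩, hxz', hyz'⟩ := hs
      obtain ⟨T, hTF, h1, h2⟩ := hT s.1.1 s.1.2 s.2 hxy' hxz' hyz'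
      rw [mem_coe, hU, mem_biUnion]
      exact ⟨T, hTF, (hmemP T s.1).mpr ⟨h1, h2, hxy'⟩⟩
    have hinj : Set.InjOn (fun t : (V × V) × V => t.1) (triangles3 D) := by
      intro s hs s' hs' h
      simp only at h
      rw [mem_coe, triangles3, mem_filter, mem_product, mem_adjPairsAll] at hs hs'
      obtain ⟨⟨hxy', -⟩, hxz', hyz'⟩ := hs
      obtain ⟨⟨-, -⟩, hxz'', hyz''⟩ := hs'
      rw [← h] at hxz'' hyz''
      exact Prod.ext h (eq_of_common_nbr D hK hxy' hxz' hyz' hxz'' hyz'')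
    have := card_le_card_of_injOn _ hmaps hinj
    omega
  -- the dichotomy: `deficit(x, y) ≥ 2` or some triangle has an outer vertex
  have hkey : 2 ≤ deficit D p ∨ ∃ T ∈ F, 1 ≤ (univ.filter (fun z => ∀ t ∈ T, ¬ D.Adj t z)).card := by
    -- an end lying in no triangle is outer for a triangle missing the other end
    have hnone : ∀ a b, D.Adj a b → (∀ T ∈ F, a ∉ T) →
        ∃ T ∈ F, 1 ≤ (univ.filter (fun z => ∀ t ∈ T, ¬ D.Adj t z)).card := by
      intro a b hab hnoT
      obtain ⟨T, hTF, hbT⟩ := exists_not_mem_of_four D hK hk F hF4 hF b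
      refine ⟨T, hTF, card_pos.mpr ⟨a, mem_filter.mpr ⟨mem_univ _, ?_⟩⟩⟩
      intro t htT hta
      rcases hmem t a hta with ⟨T', hT'F, -, haT'⟩ | ⟨h1, h2⟩ | ⟨h1, h2⟩
      · exact hnoT T' hT'F haT'
      · -- `t = x`, `a = y`: then `b = x ∈ T`
        have hb : b = p.1 := by
          have : (a, b) = p ∨ (a, b) = (p.2, p.1) := by
            have : (a, b) ∈ adjPairsAll D \ U := by
              rw [mem_sdiff, mem_adjPairsAll]
              refine ⟨hab, ?_⟩
              intro h
              rw [hU, mem_biUnion] at h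
              obtain ⟨T', hT'F, h⟩ := h
              rw [hmemP] at h
              exact hnoT T' hT'F h.1
            rw [hReq, mem_insert, mem_singleton] at this
            exact this
          rcases this with h | h
          · exact absurd ((Prod.mk.inj h).1) (by rw [h2]; exact hxy.ne.symm)
          · exact (Prod.mk.inj h).2
        rw [h1, ← hb] at htT
        exact hbT htT
      · -- `t = y`, `a = x`: then `b = y ∈ T`
        have hb : b = p.2 := by
          have : (a, b) = p ∨ (a, b) = (p.2, p.1) := by
            have : (a, b) ∈ adjPairsAll D \ U := by
              rw [mem_sdiff, mem_adjPairsAll]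
              refine ⟨hab, ?_⟩
              intro h
              rw [hU, mem_biUnion] at h
              obtain ⟨T', hT'F, h⟩ := h
              rw [hmemP] at h
              exact hnoT T' hT'F h.1
            rw [hReq, mem_insert, mem_singleton] at this
            exact this
          rcases this with h | h
          · exact (Prod.mk.inj h).2
          · exact absurd ((Prod.mk.inj h).1) (by rw [h2]; exact hxy.ne)
        rw [h1, ← hb] at htT
        exact hbT htT
    by_cases hx : ∃ A ∈ F, p.1 ∈ A
    · by_cases hy : ∃ C ∈ F, p.2 ∈ C
      · obtain ⟨A, hA, hxA⟩ := hx
        obtain ⟨C, hC, hyC⟩ := hy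
        by_cases hx2 : ∃ B ∈ F, B ≠ A ∧ p.1 ∈ B
        · obtain ⟨B, hB, hBA, hxB⟩ := hx2
          exact Or.inr (by
            obtain ⟨T, hTF, z, hz⟩ := outer_of_two_through D hK hk F hF4 hF hT hxy hmem hxyU hA hB hC
              (Ne.symm hBA) hxA hxB hyC
            exact ⟨T, hTF, card_pos.mpr ⟨z, mem_filter.mpr ⟨mem_univ _, hz⟩⟩⟩)
        · by_cases hy2 : ∃ B ∈ F, B ≠ C ∧ p.2 ∈ B
          · obtain ⟨B, hB, hBC, hyB⟩ := hy2
            exact Or.inr (by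
              have hmem' : ∀ v z, D.Adj v z → (∃ T ∈ F, v ∈ T ∧ z ∈ T) ∨ (v = p.2 ∧ z = p.1) ∨
                  (v = p.1 ∧ z = p.2) := by
                intro v z hvz
                rcases hmem v z hvz with h | h | h
                · exact Or.inl h
                · exact Or.inr (Or.inr h)
                · exact Or.inr (Or.inl h)
              have hxyU' : ∀ T ∈ F, ¬ (p.2 ∈ T ∧ p.1 ∈ T) := fun T hTF h => hxyU T hTF ⟨h.2, h.1⟩
              obtain ⟨T, hTF, z, hz⟩ := outer_of_two_through D hK hk F hF4 hF hT hxy.symm hmem' hxyU' hC hB hA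
                (Ne.symm hBC) hyC hyB hxA
              exact ⟨T, hTF, card_pos.mpr ⟨z, mem_filter.mpr ⟨mem_univ _, hz⟩⟩⟩)
          · -- both ends in exactly one triangle: `d(x) + d(y) ≤ 6`
            left
            simp only [not_exists, not_and] at hx2 hy2
            have hNx : univ.filter (fun z => D.Adj p.1 z) ⊆ A.erase p.1 ∪ {p.2} := by
              intro z hz
              rw [mem_filter] at hz
              rw [mem_union, mem_erase, mem_singleton]
              rcases hmem p.1 z hz.2 with ⟨T, hTF, h1, h2⟩ | ⟨-, h2⟩ | ⟨h1, -⟩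
              · have : T = A := by
                  by_contra hne
                  exact hx2 T hTF hne h1
                subst this
                exact Or.inl ⟨hz.2.ne.symm, h2⟩
              · exact Or.inr h2
              · exact absurd h1 hxy.ne
            have hNy : univ.filter (fun z => D.Adj p.2 z) ⊆ C.erase p.2 ∪ {p.1} := by
              intro z hz
              rw [mem_filter] at hz
              rw [mem_union, mem_erase, mem_singleton]
              rcases hmem p.2 z hz.2 with ⟨T, hTF, h1, h2⟩ | ⟨h1, -⟩ | ⟨-, h2⟩
              · have : T = C := by
                  by_contra hne
                  exact hy2 T hTF hne h1
                subst this
                exact Or.inl ⟨hz.2.ne.symm, h2⟩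
              · exact absurd h1 hxy.ne.symm
              · exact Or.inr h2
            have hA3 : A.card = 3 := by
              obtain ⟨u, v, w, huv, huw, hvw, rfl⟩ := hF A hA
              exact card_triple huv.ne huw.ne hvw.ne
            have hC3 : C.card = 3 := by
              obtain ⟨u, v, w, huv, huw, hvw, rfl⟩ := hF C hC
              exact card_triple huv.ne huw.ne hvw.ne
            have hdx := card_le_card hNx
            have hdy := card_le_card hNy
            have hu1 := card_union_le (A.erase p.1) ({p.2} : Finset V)
            have hu2 := card_union_le (C.erase p.2) ({p.1} : Finset V)
            rw [card_erase_of_mem hxA, hA3, card_singleton] at hu1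
            rw [card_erase_of_mem hyC, hC3, card_singleton] at hu2
            -- `deficit p = 8 − |N(x) ∪ N(y)|`
            have hcomp := card_filter_add_card_filter_not (s := (univ : Finset V))
              (fun t => ¬ D.Adj p.1 t ∧ ¬ D.Adj p.2 t)
            have hcov : univ.filter (fun t => ¬ (¬ D.Adj p.1 t ∧ ¬ D.Adj p.2 t)) ⊆
                univ.filter (fun z => D.Adj p.1 z) ∪ univ.filter (fun z => D.Adj p.2 z) := by
              intro t ht
              rw [mem_filter] at ht
              rw [mem_union, mem_filter, mem_filter]
              by_cases h1 : D.Adj p.1 t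
              · exact Or.inl ⟨mem_univ _, h1⟩
              · refine Or.inr ⟨mem_univ _, ?_⟩
                by_contra h2
                exact ht.2 ⟨h1, h2⟩
            have hc := card_le_card hcov
            have hu := card_union_le (univ.filter (fun z => D.Adj p.1 z)) (univ.filter (fun z => D.Adj p.2 z))
            rw [card_univ, hk] at hcomp
            unfold deficit
            omega
      · exact Or.inr (hnone p.2 p.1 hxy.symm (by simpa using hy))
    · exact Or.inr (hnone p.1 p.2 hxy (by simpa using hx))
  -- assemble
  have hid := two_mul_sum_deg_sq_add_sum_deficit D
  have hmk : 2 * (D.edgeFinset.card * Fintype.card V) = 2 * D.edgeFinset.card * Fintype.card V := by ring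
  have hUge : 40 + 4 * ∑ T ∈ F, (univ.filter (fun z => ∀ t ∈ T, ¬ D.Adj t z)).card ≤ ∑ q ∈ U, deficit D q := by
    rw [hUsum]
    have := sum_le_sum hout
    rw [sum_add_distrib, sum_const, hF4, smul_eq_mul, ← mul_sum] at this
    omega
  have hsum44 : 44 ≤ ∑ q ∈ adjPairsAll D, deficit D q := by
    rw [← hsplit, hRsum]
    rcases hkey with h | ⟨T, hTF, hT1⟩
    · omega
    · have : 1 ≤ ∑ T ∈ F, (univ.filter (fun z => ∀ t ∈ T, ¬ D.Adj t z)).card :=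
        le_trans hT1 (single_le_sum (f := fun T => (univ.filter (fun z => ∀ t ∈ T, ¬ D.Adj t z)).card)
          (fun _ _ => Nat.zero_le _) hTF)
      omega
  rw [hk, hm] at hid hmk ⊢
  omega

end C047

end TriangleCap

end PercRepro
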